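import Summits.RiemannHypothesis.RiemannHypothesis.Theses.LiAsymptotic
import Summits.RiemannHypothesis.RiemannHypothesis.Theorems.LiAsymptoticLiFarZeroTailCube
import HarnessLib

/-!
# RiemannHypothesis / LiAsymptotic — support item `LiFarZeroTailCube` closed BY NAME (RH-FREE)

RH-FREE [rh-li-prover].  Route `Theses/LiAsymptotic.lean` (rung L-P(P1⁺)), support item `LiFarZeroTailCube`
(stmt-RiemannHypothesis-19229): the cubic far-zero tail `Σ_{T<Im ρ≤U} m/(Im ρ)³ ≤ log T/(4π T²)` (`T ≥ 1000`) — the landed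
theorem `liFarZeroTailCube_bound` (`Theorems/LiAsymptoticLiFarZeroTailCube.lean`, rh-li-prover g2) restated with the
route decl as its type.  Nothing here bears on the truth of RH.
-/

noncomputable section

-- D-0017: `Summit.<S>.<S>.…` is the designed namespace of a single-problem summit.
set_option linter.dupNamespace false

namespace Summit.RiemannHypothesis.RiemannHypothesis.Theorems.LiTheory

/-- **Item `LiFarZeroTailCube` of route `LiAsymptotic`** (stmt-RiemannHypothesis-19229; RH-FREE zero counting),
closed BY NAME by the landed `liFarZeroTailCube_bound`. -/
theorem liFarZeroTailCube_proof :
    Summit.RiemannHypothesis.RiemannHypothesis.Theses.LiAsymptotic.LiFarZeroTailCube :=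
  fun T U hT hU ↦ liFarZeroTailCube_bound T U hT hU

end Summit.RiemannHypothesis.RiemannHypothesis.Theorems.LiTheory

end
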